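import Summits.Schanuel.Schanuel.Theorems.DiophantineDichotomyApproximationPropertyCycleAPIAt3Defs
import Summits.Schanuel.Schanuel.Theorems.DiophantineDichotomyApproximationPropertyPointDatumOfLineSatellite
import HarnessLib

/-!
# Stub `pointDatum_of_boundedSatellite3` of line `orbit-interpolation-determinant` (crux `ApproximationProperty`, stmt-Schanuel-6117)

Crux `stmt-Schanuel-6117` (`Summit.Schanuel.Schanuel.Theses.DiophantineDichotomy.ApproximationProperty`),
route `DiophantineDichotomy`, line `orbit-interpolation-determinant`, registered stub
`pointDatum_of_boundedSatellite3` (skeleton v12, branch (B): the BOUNDED-DEGREE satellite branch of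
the bad cut of the `t = 3` transfer; vocabulary `…CycleAPIAt3Defs.lean`; the line toolkit is
imported through the landed line-satellite sibling `…PointDatumOfLineSatellite.lean`).

A long Galois orbit `V(𝔭)` (`D = deg 𝔭 > ⌊c₁Δ⌋ + 1`, AP1 bounds at constant `c₁`, boosted scale
`(Δ, λY)`) lies on a SATELLITE `V(𝔮')` of the cut-`2` complete intersection `(Q, P)`
(`a + b ≤ 3Δ`), `1 ≤ δ' = deg 𝔮' ≤ δ⋆`. From the LOG orbit floor (the `OrbitFloor` inequality
with the extra summand `D log(L + 2)`), `SatelliteHeight` (P3′) and `ContainerRestart` (P4), taken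
as HYPOTHESES, this file PROVES the `PointAPAbsAt 3` point datum at `(Δ, Y)` — the landed
line-satellite proof run with `δ' ≤ δ⋆` in place of `δ' = 1`: (1) contrapositive floor with
`L = Δ(Δ h̄ + λY)/(32 C² c₁²)`, `C = 4 max(C_F, 1) + δ⋆`: the new summand `C_F D log(L + 2)` is
at most `S/16` (`log_absorb`), `δ' L` goes through `floor_arith` (`δ' ≤ δ⋆ ≤ C`), the `√` summand
through `sqrt_absorb` (`9δ'² ≤ 9δ⋆² ≤ Δ ≤ D`); (2) `ρ(ω̄, V(𝔮')) < e^{−L}` beats the restart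
threshold (`SatelliteHeight` made uniform in `δ' ≤ δ⋆` by a finite maximum, `2δ⋆² < D` since
`D > c₁Δ ≥ 9δ⋆²`; `restart_threshold_arith`); (3) `ContainerRestart` gives a short orbit
`𝔯 ⊇ 𝔮'`, `deg 𝔯 ≤ 4Δδ' ≤ c₂Δ`, clause automatic (`rankOne_interpolation_of_ideg_le`);
(4) `pointDatum_of_clause` extracts the point. Proofs only (no definitions, no named facts).
Sources: NesterenkoPhilippon2001 (LNM 1752) Ch. 3 §4, Ch. 4 §4 p. 61; Philippon2000; folklore.
-/

noncomputable section

-- `Summit.Schanuel.Schanuel.…` is the mandated summit/sub-problem namespace (single-conjunct summit), hence: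
set_option linter.dupNamespace false

attribute [local instance] MvPolynomial.gradedAlgebra

namespace Summit.Schanuel.Schanuel.Cruxes.ApproximationProperty.OrbitInterpolationDeterminant

open Literature.NumberTheory.Transcendental.Nesterenko MvPolynomial
open scoped BigOperators

namespace PointDatumOfBoundedSatellite

/-- **Uniform satellite height**: from `SatelliteHeight` (one constant `C(δ)` per degree `δ`), a
single constant `C = max_{δ ≤ δ⋆} C(δ)` serving every satellite of degree `1 ≤ deg 𝔮 ≤ δ⋆`
through an orbit of `D > 2δ⋆²` points: `h(𝔮) ≤ C (h(𝔭)/D + 1)`. [folklore] -/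
theorem satelliteHeight_uniform (hH : SatelliteHeight) (δstar : ℕ) :
    ∃ C : ℝ, 0 < C ∧ ∀ (𝔭 𝔮 : Ideal (Rx 3)), 𝔭.IsPrime →
      𝔭.IsHomogeneous (homogeneousSubmodule (Fin (3 + 1)) ℚ) → IsUnmixedOfRank 𝔭 1 → 𝔮.IsPrime →
      𝔮.IsHomogeneous (homogeneousSubmodule (Fin (3 + 1)) ℚ) → IsUnmixedOfRank 𝔮 2 →
      1 ≤ ideg 𝔮 2 → ideg 𝔮 2 ≤ δstar → 𝔮 ≤ 𝔭 → 2 * δstar ^ 2 < ideg 𝔭 1 →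
      iheight 𝔮 2 ≤ C * (iheight 𝔭 1 / ideg 𝔭 1 + 1) := by
  induction δstar with
  | zero =>
    exact ⟨1, one_pos, fun _ _ _ _ _ _ _ _ h1 h0 _ _ => absurd (h1.trans h0) (by norm_num)⟩
  | succ n ih =>
    obtain ⟨C, hC, hCt⟩ := ih
    obtain ⟨C', _, hC't⟩ := hH (n + 1) n.succ_pos
    refine ⟨max C C', lt_max_of_lt_left hC, ?_⟩
    intro 𝔭 𝔮 h𝔭 h𝔭hom h𝔭unm h𝔮 h𝔮hom h𝔮unm h1 hle hsub hD
    have h0 := SatelliteRestartGlue.hbar_add_one_nonneg 𝔭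
    rcases Nat.lt_or_ge (ideg 𝔮 2) (n + 1) with hlt | hge
    · have hD' : 2 * n ^ 2 < ideg 𝔭 1 :=
        lt_of_le_of_lt (Nat.mul_le_mul_left 2 (Nat.pow_le_pow_left n.le_succ 2)) hD
      exact (hCt 𝔭 𝔮 h𝔭 h𝔭hom h𝔭unm h𝔮 h𝔮hom h𝔮unm h1 (Nat.lt_succ_iff.mp hlt) hsub hD').trans
        (mul_le_mul_of_nonneg_right (le_max_left _ _) h0)
    · exact (hC't 𝔭 𝔮 h𝔭 h𝔭hom h𝔭unm h𝔮 h𝔮hom h𝔮unm (le_antisymm hle hge) hsub hD).trans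
        (mul_le_mul_of_nonneg_right (le_max_right _ _) h0)

/-- The floor scale is polynomially bounded: `Δ(Δh̄ + Y)/(32 C² c²) ≤ (cΔ)³ Y` once
`h̄ ≤ c Y Δ`, `Δ, C, c ≥ 1`, `Y ≥ 0`. [folklore] -/
theorem L_le_cube {C c Δ Y hbar : ℝ} (hC : 1 ≤ C) (hc : 1 ≤ c) (hΔ : 1 ≤ Δ) (hY : 0 ≤ Y)
    (hh : hbar ≤ c * Y * Δ) : Δ * (Δ * hbar + Y) / (32 * C ^ 2 * c ^ 2) ≤ (c * Δ) ^ 3 * Y := by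
  have hC0 : 0 < C := by linarith
  have hc0 : 0 < c := by linarith
  have hΔ0 : 0 < Δ := by linarith
  rw [div_le_iff₀ (by positivity)]
  have e1 : Δ * (Δ * hbar) ≤ c * Y * Δ ^ 3 := by
    calc Δ * (Δ * hbar) ≤ Δ * (Δ * (c * Y * Δ)) :=
          mul_le_mul_of_nonneg_left (mul_le_mul_of_nonneg_left hh hΔ0.le) hΔ0.le
      _ = c * Y * Δ ^ 3 := by ring
  have e2 : Δ * Y ≤ c * Y * Δ ^ 3 := by
    have h1 : 1 ≤ c * Δ ^ 2 := one_le_mul_of_one_le_of_one_le hc (one_le_pow₀ hΔ)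
    calc Δ * Y = Δ * Y * 1 := by ring
      _ ≤ Δ * Y * (c * Δ ^ 2) := mul_le_mul_of_nonneg_left h1 (by positivity)
      _ = c * Y * Δ ^ 3 := by ring
  have e3 : Δ * (Δ * hbar + Y) = Δ * (Δ * hbar) + Δ * Y := by ring
  have hK : (2 : ℝ) ≤ 32 * C ^ 2 * c ^ 4 := by
    have : (1 : ℝ) ≤ C ^ 2 * c ^ 4 :=
      one_le_mul_of_one_le_of_one_le (one_le_pow₀ hC) (one_le_pow₀ hc)
    linarith
  calc Δ * (Δ * hbar + Y) ≤ 2 * (c * Y * Δ ^ 3) := by rw [e3]; linarith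
    _ ≤ 32 * C ^ 2 * c ^ 4 * (c * Y * Δ ^ 3) := mul_le_mul_of_nonneg_right hK (by positivity)
    _ = (c * Δ) ^ 3 * Y * (32 * C ^ 2 * c ^ 2) := by ring

/-- **Absorbing the `D log(L + 2)` summand of the LOG floor**: `4 C c log(L + 2) ≤ Y` when
`0 ≤ L ≤ (cΔ)³ Y`, `Y ≥ Δ ≥ 3136 C² c³` (`log(L + 2) ≤ log((cΔ)³ + 2) + log Y`,
`8 C c log((cΔ)³ + 2) ≤ Δ` by `log_budget`, `8 C c log Y ≤ 16 C c √Y ≤ Y`). [folklore] -/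
theorem log_absorb {C c Δ Y L : ℝ} (hC : 1 ≤ C) (hc : 1 ≤ c) (hΔ : 3136 * C ^ 2 * c ^ 3 ≤ Δ)
    (hY : Δ ≤ Y) (hL0 : 0 ≤ L) (hL : L ≤ (c * Δ) ^ 3 * Y) :
    4 * C * c * Real.log (L + 2) ≤ Y := by
  have hC0 : 0 < C := by linarith
  have hc0 : 0 < c := by linarith
  have hCc : 1 ≤ C ^ 2 * c ^ 3 := one_le_mul_of_one_le_of_one_le (one_le_pow₀ hC) (one_le_pow₀ hc)
  have hΔ1 : 3136 ≤ Δ := by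
    have := mul_le_mul_of_nonneg_left hCc (by norm_num : (0:ℝ) ≤ 3136); linarith
  have hY0 : 0 < Y := by linarith
  have hx0 : 0 ≤ (c * Δ) ^ 3 := by positivity
  -- `log(L + 2) ≤ log((cΔ)³ + 2) + log Y`
  have hsplit : Real.log (L + 2) ≤ Real.log ((c * Δ) ^ 3 + 2) + Real.log Y := by
    rw [← Real.log_mul (by positivity) hY0.ne']
    apply Real.log_le_log (by linarith)
    nlinarith [mul_nonneg hx0 hY0.le]
  -- the polynomial part, by `log_budget` at `D := (cΔ)³`
  have hpoly : 8 * C * c * Real.log ((c * Δ) ^ 3 + 2) ≤ Δ :=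
    SatelliteRestartGlue.log_budget hC hc hΔ hx0 le_rfl
  -- the `log Y` part: `log Y ≤ 2 √Y` and `16 C c ≤ √Y`
  have hlogY : Real.log Y ≤ 2 * Real.sqrt Y := by
    have h := Real.log_le_sub_one_of_pos (Real.sqrt_pos.mpr hY0)
    rw [Real.log_sqrt hY0.le] at h
    linarith [Real.sqrt_nonneg Y]
  have hsq : 16 * C * c ≤ Real.sqrt Y := by
    apply Real.le_sqrt_of_sq_le
    have h23 : C ^ 2 * c ^ 2 ≤ C ^ 2 * c ^ 3 :=
      mul_le_mul_of_nonneg_left (pow_le_pow_right₀ hc (by norm_num)) (by positivity)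
    calc (16 * C * c) ^ 2 = 256 * (C ^ 2 * c ^ 2) := by ring
      _ ≤ 3136 * (C ^ 2 * c ^ 3) := by linarith [h23, (by positivity : (0:ℝ) ≤ C ^ 2 * c ^ 2)]
      _ ≤ Y := by linarith
  have hYpart : 8 * C * c * Real.log Y ≤ Y := by
    calc 8 * C * c * Real.log Y ≤ 8 * C * c * (2 * Real.sqrt Y) :=
          mul_le_mul_of_nonneg_left hlogY (by positivity)
      _ = 16 * C * c * Real.sqrt Y := by ring
      _ ≤ Real.sqrt Y * Real.sqrt Y := mul_le_mul_of_nonneg_right hsq (Real.sqrt_nonneg Y)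
      _ = Y := Real.mul_self_sqrt hY0.le
  have h8 : 8 * C * c * Real.log (L + 2) ≤ 8 * C * c * (Real.log ((c * Δ) ^ 3 + 2) + Real.log Y) :=
    mul_le_mul_of_nonneg_left hsplit (by positivity)
  linarith

/-- **The floor contradiction** (Step 1): if every zero of the long orbit `𝔭` (`Δ ≤ D ≤ (cΔ)³`,
`h ≤ c Y Δ²`) stayed at projective distance `≥ e^{−L}` from `ω̄`, `L = Δ(Δh̄ + Y)/(32 C² c²)`,
then the LOG orbit floor `log(1/|𝔭(ω̄)|) ≤ C_F (δ L + h + D log(D+2) + D log(L+2) + √(…))` on a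
satellite of degree `δ` (`1 ≤ δ ≤ C`, `9δ² ≤ D`, `4 C_F ≤ C`) and the smallness
`(Δ h + Y D)/c ≤ log(1/|𝔭(ω̄)|)` are incompatible: the `D log(L+2)` summand is at most `S/16`
(`log_absorb`), and after `sqrt_absorb`, `log_budget`, `floor_arith` gives `2L ≤ L`, `L > 0`.
[cite: NesterenkoPhilippon2001, Ch. 3 Prop. 4.11 (pp. 40–41); Ch. 4 §4 p. 61] -/
theorem floor_contra {CF C c Δ Y D h S L δ : ℝ} (hCF : 0 < CF) (hC4 : 4 * CF ≤ C) (hC : 1 ≤ C)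
    (hc : 1 ≤ c) (hΔ8 : 8 * C * c ≤ Δ) (hΔbig : 3136 * C ^ 2 * c ^ 3 ≤ Δ) (hY : Δ ≤ Y)
    (hDΔ : Δ ≤ D) (hδ1 : 1 ≤ δ) (hδC : δ ≤ C) (hδD : 9 * δ ^ 2 ≤ D) (hDle : D ≤ (c * Δ) ^ 3)
    (hh : 0 ≤ h) (hhY : h ≤ c * Y * Δ ^ 2)
    (hL : L = Δ * (Δ * (h / D) + Y) / (32 * C ^ 2 * c ^ 2))
    (hlow : (Δ * h + Y * D) / c ≤ S)
    (hup : S ≤ CF * (δ * L + h + D * Real.log (D + 2) + D * Real.log (L + 2) +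
      Real.sqrt (D * (h + D + δ * Real.log (D + 2)) * L))) : False := by
  have hC0 : 0 < C := by linarith
  have hc0 : 0 < c := by linarith
  have hCc : 1 ≤ C * c := one_le_mul_of_one_le_of_one_le hC hc
  have hΔ1 : 1 ≤ Δ := by linarith
  have hΔ0 : 0 < Δ := by linarith
  have hY0 : 0 < Y := by linarith
  have hD1 : 1 ≤ D := by linarith
  have hD0 : 0 < D := by linarith
  have hδ0 : 0 ≤ δ := by linarith
  have hDh : D * (h / D) = h := mul_div_cancel₀ _ hD0.ne'
  have hhbar0 : 0 ≤ h / D := div_nonneg hh hD0.le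
  -- `h̄ = h/D ≤ c Y Δ`
  have hhb : h / D ≤ c * Y * Δ := by
    rw [div_le_iff₀ hD0]
    calc h ≤ c * Y * Δ ^ 2 := hhY
      _ = c * Y * Δ * Δ := by ring
      _ ≤ c * Y * Δ * D := mul_le_mul_of_nonneg_left hDΔ (by positivity)
  have hL1 : 1 ≤ L := by rw [hL]; exact PointDatumOfLineSatellite.one_le_L hC hc hΔ8 hY hhbar0
  have hL0 : 0 ≤ L := by linarith
  -- the new `D log(L+2)` summand: `4 C c log(L+2) ≤ Y`, whence `C_F D log(L+2) ≤ S/16`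
  have hLle : L ≤ (c * Δ) ^ 3 * Y := by rw [hL]; exact L_le_cube hC hc hΔ1 hY0.le hhb
  have hlogL : 4 * C * c * Real.log (L + 2) ≤ Y := log_absorb hC hc hΔbig hY hL0 hLle
  have hlogL0 : 0 ≤ Real.log (L + 2) := Real.log_nonneg (by linarith)
  have hSc : Δ * h + Y * D ≤ S * c := (div_le_iff₀ hc0).mp hlow
  have hDlog : 0 ≤ D * Real.log (L + 2) := mul_nonneg hD0.le hlogL0
  have hextra : CF * (D * Real.log (L + 2)) ≤ S / 16 := by
    have e1 : CF * (D * Real.log (L + 2)) ≤ C / 4 * (D * Real.log (L + 2)) :=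
      mul_le_mul_of_nonneg_right (by linarith) hDlog
    have e2 : D * (4 * C * c * Real.log (L + 2)) ≤ D * Y := mul_le_mul_of_nonneg_left hlogL hD0.le
    have e3 : C / 4 * (D * Real.log (L + 2)) * 16 * c ≤ S * c := by
      linarith only [e2, hSc, mul_nonneg hΔ0.le hh]
    have e4 : C / 4 * (D * Real.log (L + 2)) * 16 ≤ S := le_of_mul_le_mul_right e3 hc0
    linarith only [e1, e4]
  have hsqrt := SatelliteRestartGlue.sqrt_absorb (δ := δ) hD1 hh hL0 hδ0 hδD
  have hlog0 : 0 ≤ Real.log (D + 2) := Real.log_nonneg (by linarith)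
  have hstuff : 0 ≤ δ * L + h + D * Real.log (D + 2) := by positivity
  -- `S ≤ 2 C_F (δ L + h + D log(D+2) + √(…)) ≤ 4 C_F (… + √(D(h+D)L)) ≤ C (…)`
  have hS2 : S ≤ 2 * CF * (δ * L + h + D * Real.log (D + 2) +
      Real.sqrt (D * (h + D + δ * Real.log (D + 2)) * L)) := by
    have hA : 0 ≤ CF * (δ * L + h + D * Real.log (D + 2) +
        Real.sqrt (D * (h + D + δ * Real.log (D + 2)) * L)) := mul_nonneg hCF.le (by positivity)
    linarith only [hup, hextra, hA]
  have hS4 : S ≤ C * (δ * L + h + D * Real.log (D + 2) + Real.sqrt (D * (h + D) * L)) := by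
    have e1 : 2 * CF * Real.sqrt (D * (h + D + δ * Real.log (D + 2)) * L) ≤
        2 * CF * (2 * Real.sqrt (D * (h + D) * L)) :=
      mul_le_mul_of_nonneg_left hsqrt (by positivity)
    have e2 : 4 * CF * (δ * L + h + D * Real.log (D + 2) + Real.sqrt (D * (h + D) * L)) ≤
        C * (δ * L + h + D * Real.log (D + 2) + Real.sqrt (D * (h + D) * L)) :=
      mul_le_mul_of_nonneg_right hC4 (by positivity)
    have e3 : 0 ≤ CF * (δ * L + h + D * Real.log (D + 2)) := mul_nonneg hCF.le hstuff
    linarith only [hS2, e1, e2, e3]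
  -- the floor inequality in the shape of `floor_arith` (constant `C ≥ 4 C_F`, `h̄ = h / D`)
  have hfloor : D * (Δ * (h / D) + Y) / c ≤
      C * (δ * L + D * (h / D) + D * Real.log (D + 2) + Real.sqrt (D * (D * (h / D) + D) * L)) := by
    have e1 : D * (Δ * (h / D) + Y) = Δ * h + Y * D := by
      calc D * (Δ * (h / D) + Y) = Δ * (D * (h / D)) + Y * D := by ring
        _ = Δ * h + Y * D := by rw [hDh]
    rw [e1, hDh]
    exact hlow.trans hS4
  have hlogb : 8 * C * c * Real.log (D + 2) ≤ Y :=
    (SatelliteRestartGlue.log_budget hC hc hΔbig hD0.le hDle).trans hY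
  have hDδ : Δ * δ ≤ 4 * C * c * D := by
    calc Δ * δ ≤ D * C := mul_le_mul hDΔ hδC hδ0 hD0.le
      _ = 1 * (C * D) := by ring
      _ ≤ 4 * c * (C * D) := mul_le_mul_of_nonneg_right (by linarith) (by positivity)
      _ = 4 * C * c * D := by ring
  have hconc := floor_arith C c Δ Y D (h / D) L δ hC hc hΔ8 hY hlogb hD1 hhbar0 hδ1 hDδ hL1 hfloor
  rw [hL, div_le_div_iff₀ (by positivity) (by positivity)] at hconc
  have hpos : 0 < Δ * (Δ * (h / D) + Y) * (C ^ 2 * c ^ 2) := by positivity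
  linarith only [hconc, hpos]

/-- **The height budget of the restarted orbit** (Step 6 of the stub): from
`h(𝔯) ≤ C_R (Δ h(𝔮') + Y δ')`, `0 ≤ δ' ≤ δ⋆`, `h(𝔮') ≤ p (h̄ + 1)`, `h̄ = h/D ≤ Y Δ`
(`h ≤ c₁ Y Δ²`, `D ≥ c₁Δ`) one gets `h(𝔯) ≤ C_R (2p + δ⋆) Y Δ² ≤ c₂ Y Δ²`. [folklore] -/
theorem height_budget {CR p c₁ c₂ Δ Y D h hq hr δ δs : ℝ} (hCR : 0 ≤ CR) (hp : 0 ≤ p)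
    (hδ0 : 0 ≤ δ) (hδ : δ ≤ δs) (hc₂ : CR * (2 * p + δs) ≤ c₂) (hΔ : 1 ≤ Δ) (hY : Δ ≤ Y)
    (hD : c₁ * Δ ≤ D) (hD0 : 0 < D) (hh : h ≤ c₁ * Y * Δ ^ 2) (hhq : hq ≤ p * (h / D + 1))
    (hhr : hr ≤ CR * (Δ * hq + Y * δ)) : hr ≤ c₂ * Y * Δ ^ 2 := by
  have hY0 : 0 ≤ Y := by linarith
  have hΔ0 : 0 ≤ Δ := by linarith
  have hYΔ : 1 ≤ Y * Δ := one_le_mul_of_one_le_of_one_le (hΔ.trans hY) hΔ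
  have hΔ2 : 1 ≤ Δ ^ 2 := one_le_pow₀ hΔ
  have h1 : h / D ≤ Y * Δ := by
    rw [div_le_iff₀ hD0]
    calc h ≤ c₁ * Y * Δ ^ 2 := hh
      _ = Y * Δ * (c₁ * Δ) := by ring
      _ ≤ Y * Δ * D := mul_le_mul_of_nonneg_left hD (by positivity)
  have h2 : Δ * hq ≤ 2 * p * Y * Δ ^ 2 := by
    have e1 : hq ≤ p * (Y * Δ + 1) := hhq.trans (mul_le_mul_of_nonneg_left (by linarith) hp)
    have e3 : hq ≤ p * (2 * (Y * Δ)) := e1.trans (mul_le_mul_of_nonneg_left (by linarith) hp)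
    calc Δ * hq ≤ Δ * (p * (2 * (Y * Δ))) := mul_le_mul_of_nonneg_left e3 hΔ0
      _ = 2 * p * Y * Δ ^ 2 := by ring
  have h3 : Y * δ ≤ δs * (Y * Δ ^ 2) := by
    calc Y * δ ≤ Y * δs := mul_le_mul_of_nonneg_left hδ hY0
      _ = δs * Y * 1 := by ring
      _ ≤ δs * Y * Δ ^ 2 := mul_le_mul_of_nonneg_left hΔ2 (mul_nonneg (hδ0.trans hδ) hY0)
      _ = δs * (Y * Δ ^ 2) := by ring
  calc hr ≤ CR * (Δ * hq + Y * δ) := hhr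
    _ ≤ CR * (2 * p * Y * Δ ^ 2 + δs * (Y * Δ ^ 2)) :=
        mul_le_mul_of_nonneg_left (add_le_add h2 h3) hCR
    _ = CR * (2 * p + δs) * (Y * Δ ^ 2) := by ring
    _ ≤ c₂ * (Y * Δ ^ 2) := mul_le_mul_of_nonneg_right hc₂ (by positivity)
    _ = c₂ * Y * Δ ^ 2 := by ring

end PointDatumOfBoundedSatellite

/-- **Stub `pointDatum_of_boundedSatellite3`** (crux `stmt-Schanuel-6117`, line
`orbit-interpolation-determinant`; branch (B) of skeleton v12, the bounded-degree satellite branch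
of the bad cut of the `t = 3` transfer): `(LOG orbit floor) → SatelliteHeight → ContainerRestart →`
for every `δ⋆ ≥ 1`, `ω ∈ ℂ³` and `c₁ ≥ 1` there are `λ ≥ 1` and `c ≥ c₁` such that, for
`Y ≥ Δ ≥ c`, a long prime orbit `𝔭` (`⌊c₁Δ⌋ + 1 < deg 𝔭`, AP1 bounds at constant `c₁` and scale
`(Δ, λY)`) lying on a SATELLITE `V(𝔮')` of degree `≤ δ⋆` (`𝔮' ∋ Q, P`, `(Q)` prime, `P ∉ (Q)`,
`a + b ≤ 3Δ`) yields a `PointAPAbsAt 3`-datum at `(Δ, Y)`: the smallness of the orbit forces `ω̄`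
within `e^{−L}` of the satellite (LOG orbit floor, contrapositive), the satellite is restarted
(`ContainerRestart`, its height controlled by `SatelliteHeight` since `deg 𝔭 > c₁Δ ≥ 9δ⋆²`) into
a short orbit whose clause is automatic, and `pointDatum_of_clause` extracts the point.
[cite: NesterenkoPhilippon2001, Ch. 3 Prop. 4.11 (pp. 40–41), Cor. 4.10; Ch. 4 §4 p. 61] -/
theorem pointDatum_of_boundedSatellite3 : (∀ ω : Fin 3 → ℂ, ∃ C : ℝ, 0 < C ∧ ∀ (𝔭 𝔮 : Ideal (Rx 3)) (L : ℝ), 𝔭.IsPrime → 𝔭.IsHomogeneous (homogeneousSubmodule (Fin (3 + 1)) ℚ) → IsUnmixedOfRank 𝔭 1 → 𝔮.IsPrime → 𝔮.IsHomogeneous (homogeneousSubmodule (Fin (3 + 1)) ℚ) → IsUnmixedOfRank 𝔮 2 → 𝔮 ≤ 𝔭 → 1 ≤ L → (∀ β ∈ projZeros 𝔭, Real.exp (-L) ≤ projDist (Fin.cons 1 ω) β) → Real.log (1 / iabs 𝔭 1 (Fin.cons 1 ω)) ≤ C * ((ideg 𝔮 2 : ℝ) * L + iheight 𝔭 1 +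 (ideg 𝔭 1 : ℝ) * Real.log ((ideg 𝔭 1 : ℝ) + 2) + (ideg 𝔭 1 : ℝ) * Real.log (L + 2) + Real.sqrt ((ideg 𝔭 1 : ℝ) * (iheight 𝔭 1 + ideg 𝔭 1 + (ideg 𝔮 2 : ℝ) * Real.log ((ideg 𝔭 1 : ℝ) + 2)) * L))) → SatelliteHeight → ContainerRestart → ∀ δstar : ℕ, 1 ≤ δstar → ∀ (ω : Fin 3 → ℂ) (c₁ : ℝ), 1 ≤ c₁ → ∃ lam : ℝ, 1 ≤ lam ∧ ∃ c : ℝ, c₁ ≤ c ∧ ∀ Δ Y : ℝ, c ≤ Δ → Δ ≤ Y → ∀ (Q : Rx 3) (a : ℕ) (P : Rx 3) (b : ℕ) (𝔮' 𝔭 : Ideal (Rx 3)), Q ≠ 0 → Q.IsHomogeneous a → P.IsHomogeneous b → 1 ≤ a → 1 ≤ b → (a : ℝ) + b ≤ 3 * Δ → (Ideal.span {Q}).IsPrime → P ∉ Ideal.span {Q} → 𝔮'.IsPrime → 𝔮'.IsHomogeneous (homogeneousSubmodule (Fin (3 + 1)) ℚ) → IsUnmixedOfRank 𝔮' 2 →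 Q ∈ 𝔮' → P ∈ 𝔮' → ideg 𝔮' 2 ≤ δstar → 𝔭.IsPrime → 𝔭.IsHomogeneous (homogeneousSubmodule (Fin (3 + 1)) ℚ) → IsUnmixedOfRank 𝔭 1 → 𝔮' ≤ 𝔭 → ⌊c₁ * Δ⌋₊ + 1 < ideg 𝔭 1 → (ideg 𝔭 1 : ℝ) ≤ (c₁ * Δ) ^ 3 → iheight 𝔭 1 ≤ c₁ * (lam * Y) * Δ ^ 2 → iabs 𝔭 1 (Fin.cons 1 ω) ≤ Real.exp (-((Δ * iheight 𝔭 1 + lam * Y * ideg 𝔭 1) / c₁)) → ∃ (K : Type) (_ : Field K) (_ : NumberField K) (β : Fin 3 → K) (σ : K →+* ℂ), (Module.finrank ℚ K : ℝ) ≤ (c * Δ) ^ 3 ∧ Height.logHeight (Fin.cons (1 : K) β : Fin (3 + 1) → K) ≤ c * Y * Δ ^ 2 ∧ ‖(fun j => σ (β j)) - ω‖ ≤ Real.exp (-((Δ * Height.logHeight (Fin.cons (1 : K) β : Fin (3 + 1) → K) + Y * Module.finrank ℚ K) / c)) := by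
  intro hF hH hR δstar hδstar ω c₁ hc₁
  classical
  obtain ⟨C_F, hC_F, hFt⟩ := hF ω
  obtain ⟨C_H, _hC_H, hHt⟩ := PointDatumOfBoundedSatellite.satelliteHeight_uniform hH δstar
  obtain ⟨C_R, hC_R, hRt⟩ := hR ω
  have hδs1 : (1 : ℝ) ≤ δstar := by exact_mod_cast hδstar
  -- constants: `C₂ = 4 max(C_F, 1) + δ⋆` (floor), `p = max(C_H, 1)` (height), `c₂` (certification)
  obtain ⟨C₂, hC₂def⟩ : ∃ C₂ : ℝ, C₂ = 4 * max C_F 1 + δstar := ⟨_, rfl⟩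
  obtain ⟨p, hpdef⟩ : ∃ p : ℝ, p = max C_H 1 := ⟨_, rfl⟩
  have hC₂1 : 1 ≤ C₂ := by rw [hC₂def]; linarith [le_max_right C_F 1]
  have hCFC₂ : 4 * C_F ≤ C₂ := by rw [hC₂def]; linarith [le_max_left C_F 1]
  have hδC₂ : (δstar : ℝ) ≤ C₂ := by rw [hC₂def]; linarith [le_max_right C_F 1]
  have hC₂0 : 0 ≤ C₂ := by linarith
  have hp1 : 1 ≤ p := by rw [hpdef]; exact le_max_right _ _
  have hp0 : 0 ≤ p := by linarith
  have hCHp : C_H ≤ p := by rw [hpdef]; exact le_max_left _ _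
  have hC_R0 : 0 ≤ C_R := by linarith
  have hc₁0 : 0 ≤ c₁ := by linarith
  obtain ⟨c₂, hc₂def⟩ : ∃ c₂ : ℝ, c₂ = c₁ +
      16 * C_R * (32 * C₂ ^ 2) * c₁ ^ 2 * (p + 1) * δstar + C_R * (2 * p + δstar) +
      9 * (δstar : ℝ) ^ 2 + 3136 * C₂ ^ 2 * c₁ ^ 3 + 8 * C₂ * c₁ + 4 * δstar := ⟨_, rfl⟩
  have t1 : 0 ≤ 16 * C_R * (32 * C₂ ^ 2) * c₁ ^ 2 * (p + 1) * δstar := by positivity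
  have t2 : 0 ≤ C_R * (2 * p + δstar) := by positivity
  have t3 : 0 ≤ 3136 * C₂ ^ 2 * c₁ ^ 3 := by positivity
  have t4 : 0 ≤ 8 * C₂ * c₁ := by positivity
  have t5 : 0 ≤ 9 * (δstar : ℝ) ^ 2 := by positivity
  have hc₁c₂ : c₁ ≤ c₂ := by rw [hc₂def]; linarith
  have h16c₂ : 16 * C_R * (32 * C₂ ^ 2) * c₁ ^ 2 * (p + 1) * δstar ≤ c₂ := by
    rw [hc₂def]; linarith
  have hCR2p : C_R * (2 * p + δstar) ≤ c₂ := by rw [hc₂def]; linarith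
  have h9c₂ : 9 * (δstar : ℝ) ^ 2 ≤ c₂ := by rw [hc₂def]; linarith
  have h3136 : 3136 * C₂ ^ 2 * c₁ ^ 3 ≤ c₂ := by rw [hc₂def]; linarith
  have h8c₂ : 8 * C₂ * c₁ ≤ c₂ := by rw [hc₂def]; linarith
  have h4δc₂ : 4 * (δstar : ℝ) ≤ c₂ := by rw [hc₂def]; linarith
  have hCRc₂ : C_R ≤ c₂ :=
    (le_mul_of_one_le_right hC_R0 (by linarith : (1 : ℝ) ≤ 2 * p + δstar)).trans hCR2p
  have hc₂1 : 1 ≤ c₂ := hc₁.trans hc₁c₂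
  have h32 : (1 : ℝ) ≤ 32 * C₂ ^ 2 :=
    one_le_mul_of_one_le_of_one_le (by norm_num) (one_le_pow₀ hC₂1)
  -- the landed per-scale transfer at the certification constant `c₂`
  obtain ⟨lam, hlam, c, hc, hT⟩ := pointDatum_of_clause 3 (by norm_num) stub_zeroDimDictionary
    (stub_sharpClosestPoint stub_orbitClusterBound stub_zeroDimDictionary) ω c₂ hc₂1
  refine ⟨lam, hlam, c, hc₁c₂.trans hc, ?_⟩
  intro Δ Y hΔ hY Q a P b 𝔮' 𝔭 hQ0 hQa hPb ha hb hab hQprime hPQ h𝔮' h𝔮'hom h𝔮'unm hQ𝔮' hP𝔮'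
    hdegle h𝔭 h𝔭hom h𝔭unm hle hDlong hdeg hht habs
  have hc₂Δ : c₂ ≤ Δ := hc.trans hΔ
  have hΔ1 : 1 ≤ Δ := hc₂1.trans hc₂Δ
  have hΔ0 : 0 < Δ := by linarith
  have hY0 : 0 < Y := by linarith
  have hY' : Δ ≤ lam * Y := hY.trans (le_mul_of_one_le_left hY0.le hlam)
  have h8Δ : 8 * C₂ * c₁ ≤ Δ := h8c₂.trans hc₂Δ
  have h3136Δ : 3136 * C₂ ^ 2 * c₁ ^ 3 ≤ Δ := h3136.trans hc₂Δ
  -- the orbit is long: `D > c₁ Δ ≥ Δ ≥ 9 δ⋆²`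
  have hDgt : c₁ * Δ < (ideg 𝔭 1 : ℝ) := by
    have h1 : c₁ * Δ < (⌊c₁ * Δ⌋₊ : ℝ) + 1 := Nat.lt_floor_add_one _
    have h2 : (⌊c₁ * Δ⌋₊ : ℝ) + 1 < (ideg 𝔭 1 : ℝ) := by exact_mod_cast hDlong
    linarith
  have hDΔ : Δ ≤ (ideg 𝔭 1 : ℝ) := (le_mul_of_one_le_left hΔ0.le hc₁).trans hDgt.le
  have hD0 : (0 : ℝ) < ideg 𝔭 1 := by linarith
  have h2δ : 2 * δstar ^ 2 < ideg 𝔭 1 := by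
    have h1 : ((2 * δstar ^ 2 : ℕ) : ℝ) ≤ c₁ * Δ := by
      push_cast
      linarith [sq_nonneg (δstar : ℝ), le_mul_of_one_le_left hΔ0.le hc₁]
    have h3 : ⌊c₁ * Δ⌋₊ < ideg 𝔭 1 := by omega
    exact lt_of_le_of_lt (Nat.le_floor h1) h3
  have hhbar0 : 0 ≤ iheight 𝔭 1 / (ideg 𝔭 1 : ℝ) := div_nonneg (height_nonneg _) hD0.le
  -- the satellite degree `1 ≤ δ' ≤ δ⋆`
  have hδ'1 : 1 ≤ ideg 𝔮' 2 := SatelliteRestartGlue.one_le_ideg_two h𝔮' h𝔮'hom h𝔮'unm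
  have hδ'1R : (1 : ℝ) ≤ ideg 𝔮' 2 := by exact_mod_cast hδ'1
  have hδ'le : (ideg 𝔮' 2 : ℝ) ≤ δstar := by exact_mod_cast hdegle
  have hδ'0 : (0 : ℝ) ≤ ideg 𝔮' 2 := Nat.cast_nonneg _
  have h9δ' : 9 * (ideg 𝔮' 2 : ℝ) ^ 2 ≤ ideg 𝔭 1 := by
    have e1 : (ideg 𝔮' 2 : ℝ) ^ 2 ≤ (δstar : ℝ) ^ 2 := pow_le_pow_left₀ hδ'0 hδ'le 2
    linarith
  -- Step 1: the floor scale `L` and a zero of `𝔭` within `e^{-L}` of `ω̄` (contrapositive floor)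
  obtain ⟨L, hLdef⟩ : ∃ L : ℝ,
      L = Δ * (Δ * (iheight 𝔭 1 / (ideg 𝔭 1 : ℝ)) + lam * Y) / (32 * C₂ ^ 2 * c₁ ^ 2) := ⟨_, rfl⟩
  have hL1 : 1 ≤ L := by
    rw [hLdef]; exact PointDatumOfLineSatellite.one_le_L hC₂1 hc₁ h8Δ hY' hhbar0
  have hnear : ∃ β ∈ projZeros 𝔭, projDist (Fin.cons 1 ω) β < Real.exp (-L) := by
    by_contra hfar
    push Not at hfar
    have hpos : 0 < iabs 𝔭 1 (Fin.cons 1 ω) :=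
      iabs_pos_of_far 𝔭 ω h𝔭 h𝔭hom h𝔭unm fun β hβ => (Real.exp_pos _).trans_le (hfar β hβ)
    have hlow : (Δ * iheight 𝔭 1 + lam * Y * ideg 𝔭 1) / c₁ ≤
        Real.log (1 / iabs 𝔭 1 (Fin.cons 1 ω)) := by
      rw [one_div, Real.log_inv]
      exact le_neg.mpr ((Real.log_le_iff_le_exp hpos).mpr habs)
    have hup := hFt 𝔭 𝔮' L h𝔭 h𝔭hom h𝔭unm h𝔮' h𝔮'hom h𝔮'unm hle hL1 hfar
    exact PointDatumOfBoundedSatellite.floor_contra hC_F hCFC₂ hC₂1 hc₁ h8Δ h3136Δ hY' hDΔ hδ'1R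
      (hδ'le.trans hδC₂) h9δ' hdeg (height_nonneg _) hht hLdef hlow hup
  -- Step 2: `ρ(ω̄, V(𝔮')) < e^{-L}` (a zero of `𝔭 ⊇ 𝔮'` is a zero of `𝔮'`)
  obtain ⟨β, hβ, hβlt⟩ := hnear
  have hβ' : β ∈ projZeros 𝔮' := ⟨hβ.1, fun f hf => hβ.2 f (hle hf)⟩
  have hρlt : rho (Fin.cons 1 ω) 𝔮' < Real.exp (-L) := (rho_le_projDist _ hβ').trans_lt hβlt
  -- Step 3: the restart threshold of the satellite is below `L`
  have hhq : iheight 𝔮' 2 ≤ p * (iheight 𝔭 1 / (ideg 𝔭 1 : ℝ) + 1) :=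
    (hHt 𝔭 𝔮' h𝔭 h𝔭hom h𝔭unm h𝔮' h𝔮'hom h𝔮'unm hδ'1 hdegle hle h2δ).trans
      (mul_le_mul_of_nonneg_right hCHp (SatelliteRestartGlue.hbar_add_one_nonneg 𝔭))
  have h16' : 16 * C_R * (32 * C₂ ^ 2) * c₁ ^ 2 * (p + 1) * (ideg 𝔮' 2 : ℝ) ≤ c₂ :=
    (mul_le_mul_of_nonneg_left hδ'le (by positivity)).trans h16c₂
  have hthr : C_R * (Δ / c₂ + 1) * (Δ * iheight 𝔮' 2 + lam * Y * ideg 𝔮' 2) ≤ L :=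
    restart_threshold_arith C_R (32 * C₂ ^ 2) c₁ c₂ Δ (lam * Y) (iheight 𝔭 1 / (ideg 𝔭 1 : ℝ))
      (iheight 𝔮' 2) (ideg 𝔮' 2) p L hC_R h32 hc₁ hp1 hδ'1R h16' hc₂Δ hY' hhbar0 hhq
      (le_of_eq hLdef.symm)
  -- Step 4: restart the satellite at constant `c₂` and scale `(Δ, λY)`
  obtain ⟨𝔯, h𝔯, h𝔯hom, h𝔯unm, -, hdeg𝔯, hht𝔯, habs𝔯⟩ := hRt Q P a b 𝔮' hQ0 hQa hPb ha hb hQprime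
    hPQ h𝔮' h𝔮'hom h𝔮'unm hQ𝔮' hP𝔮' c₂ Δ (lam * Y) hCRc₂ hc₂Δ hY' hab
    (hρlt.le.trans (Real.exp_le_exp.mpr (neg_le_neg hthr)))
  -- Step 5: the clause is automatic for the short orbit `𝔯` (`deg 𝔯 ≤ 4Δδ' ≤ c₂Δ ≤ ⌊c₂Δ⌋ + 1`)
  have hdeg𝔯c : (ideg 𝔯 1 : ℝ) ≤ c₂ * Δ := by
    calc (ideg 𝔯 1 : ℝ) ≤ 4 * Δ * ideg 𝔮' 2 := hdeg𝔯
      _ ≤ 4 * Δ * δstar := mul_le_mul_of_nonneg_left hδ'le (by positivity)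
      _ = 4 * (δstar : ℝ) * Δ := by ring
      _ ≤ c₂ * Δ := mul_le_mul_of_nonneg_right h4δc₂ hΔ0.le
  have hclause := rankOne_interpolation_of_ideg_le 3 𝔯 ⌊c₂ * Δ⌋₊ h𝔯 h𝔯hom h𝔯unm
    (by have := Nat.le_floor hdeg𝔯c; omega)
  -- Step 6: the per-scale transfer
  have hdeg𝔯3 : (ideg 𝔯 1 : ℝ) ≤ (c₂ * Δ) ^ 3 :=
    hdeg𝔯c.trans (le_self_pow₀ (one_le_mul_of_one_le_of_one_le hc₂1 hΔ1) three_ne_zero)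
  have hht𝔯' : iheight 𝔯 1 ≤ c₂ * (lam * Y) * Δ ^ 2 :=
    PointDatumOfBoundedSatellite.height_budget hC_R0 hp0 hδ'0 hδ'le hCR2p hΔ1 hY' hDgt.le hD0 hht
      hhq hht𝔯
  exact hT Δ Y hΔ hY 𝔯 h𝔯 h𝔯hom h𝔯unm hdeg𝔯3 hht𝔯' habs𝔯 hclause

end Summit.Schanuel.Schanuel.Cruxes.ApproximationProperty.OrbitInterpolationDeterminant

end
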